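import Summits.QuantumFields.QCD.Theses.SpectralDefectExtinction
import Summits.QuantumFields.QCD.Theorems.SpectralDefectExtinctionExtinctionBuildsQCDStubSignHalfOfExtinct
import Summits.QuantumFields.QCD.Theorems.SpectralDefectExtinctionExtinctionBuildsQCDStubHonestPartitionPos
import Summits.QuantumFields.QCD.Theorems.SpectralDefectExtinctionExtinctionBuildsQCDStubWellBudget
import Summits.QuantumFields.QCD.Theorems.SpectralDefectExtinctionExtinctionBuildsQCDStubAgmonOuterFloor
import Summits.QuantumFields.QCD.Theorems.SpectralDefectExtinctionExtinctionBuildsQCDStubWindowModesLocalised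
import Summits.QuantumFields.QCD.Theorems.SpectralDefectExtinctionExtinctionBuildsQCDStubBadBoxLocal
import Summits.QuantumFields.QCD.Theorems.SpectralDefectExtinctionExtinctionBuildsQCDStubSeaWeightPositive
import Summits.QuantumFields.QCD.Theorems.SpectralDefectExtinctionExtinctionBuildsQCDStubSeaWeightSymmetric
import Summits.QuantumFields.QCD.Theorems.SpectralDefectExtinctionExtinctionBuildsQCDStubSeaWeightReflectionPositive
import Literature.MathematicalPhysics.QuantumFieldTheory.QCDPhaseQuenched
import Literature.MathematicalPhysics.QuantumLattice.WilsonDiracAP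
import Literature.MathematicalPhysics.QuantumLattice.RepLieAlgebraUnitary
import Literature.MathematicalPhysics.QuantumFieldTheory.QuasiLocalGaugePerturbation
import Literature.MathematicalPhysics.QuantumFieldTheory.TorusConfigShift
import Literature.MathematicalPhysics.QuantumFieldTheory.QCDAsymptoticScalingCouplingDivergence
import Summits.QuantumFields.QCD.Theorems.SpectralDefectExtinctionExtinctionBuildsQCDStubHonestExpectAPEqHaarRatio

/-!
# Line `block-away-the-sign` (slug `Sketch-ideator2-18064`) — crux proof skeleton v14 (lead c3; = v13 of lead c2, re-verified
# and re-registered 2026-08-17T10:1xZ: rc 0, 4 sorries = the 4 registered stubs R/G1/G36/T, no signature change; the by-name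
# re-pointing of Stub R is still blocked by the stale farm olean of `HeavyThresholdYMBridge`, probe `work/probe_node.lean`)

Crux stmt-QuantumFields-18064 `Summit.QuantumFields.QCD.Theses.SpectralDefectExtinction.ExtinctionBuildsQCD`
(`∀ N_f ∈ {2,3}, SD⁺(N_f) → THR(N_f)`).

v9 = the c1 lead's deferred RESHAPE of the honest-sea core C′ (`stub_seaCore'`, v5–v8) along the interface of the
node `HeavyThresholdYMBridge.RobustYangMillsRG` rev 3 (stmt-QuantumFields-17812), typed HERE (18031's shared-interface
proposal p139092 bounced on a gate restart and is not in the tree):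

  C′  =  G36 `stub_coreOfBlockGap`  ∘  [node R in positive-format form: `RobustYangMillsRGPosNode`]  ∘  G2b `stub_honestExpectAP_eq_haarRatio`
         ∘  G1 `stub_seaBlockFormat`,

derived as the theorem `seaCore_of` below.  Registered stubs (v10: 5; v11: 4 after G2b LANDED p149139; v12: R/G1/G36/T re-pointed to
the POSITIVE-FORMAT node after the disprover's §8a line audit — misstated-stub repair; v13: G1 narrowed to its BLOCK clauses
`BlockFormatPosAt`, the seven fine clauses being assembled in the skeleton from the landed Σ/Θ/Π — `fineClausesAt_seaWeightAP`):

* R   `stub_robustYangMillsRG`          — node stmt-17812, as `RobustYangMillsRGNode` = its rev-3 body VERBATIM, let-free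
                                           (the by-name import is impossible while the farm serves a stale rev-2 olean of
                                           `HeavyThresholdYMBridge` — see the docstring of `RobustYangMillsRGNode`);
* G1  `stub_seaBlockFormat`             — SEA BLOCK FORMAT: the SD⁺ witness's honest all-antiperiodic sea weight
                                           `w = e^{−β_k S_W}·Re∏_f det D_W^{AP}(m_f(k))` is ADMISSIBLE for the node
                                           (its `AdmAt`, all clauses, typed let-free as `AdmissibleAt`) at one block
                                           scale, for every block-coupling threshold `β₀` — the ONLY place this crux
                                           differs from 14667/18031 (SD⁺'s EXTINCT + the landed wells localisation
                                           W1–W4 are to bound the sea part of the sup-small remainder `W`); fine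
                                           clauses 1–7 are LANDED (Σ p140739, Θ p140751, Π p141689); the blocking /
                                           coercive-format clause is block-fermion RG with a dynamical SU(3) field —
                                           OPEN-PROBLEM (Bałaban class, not in print);
* G2b `stub_honestExpectAP_eq_haarRatio` — measure bookkeeping `μ_W = Z⁻¹ e^{−βS_W}·Haar`: the honest functional of
                                           C′/T equals the node's Haar-ratio functional of `w` — LANDED p149139 (wave 1, c2),
                                           imported (no longer a stub);
* G36 `stub_coreOfBlockGap`             — the FINE/OS LEG: from the node's block-level slab clustering of the honest
                                           functional (plus the format data and the SD⁺ data, since the block gap is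
                                           blind below `ℓ₀`) to the gluonic OS core package — YM-GRADE (= 18031's KΩ,
                                           14667's fine leg);
* T   `stub_flavouredThreshold`         — flavoured threshold QCD from the core package — CRUX-SIZED (X2–X5), verbatim
                                           the v3–v8 registration.

Composition `ExtinctionBuildsQCD_of = T ∘ seaCore_of ∘ (E, P, hypPQ_of_raw)`, kernel-checked; `sorry` occurs ONLY in the
four remaining `stub_*` declarations (R, G1, G36, T).  Landed supports now CONSUMED by the composition: E, P, Σ, Θ, Π, G2b
(W1–W4, W, F, T-diag are tools for the provers of G1 / T).  Landed supports imported: E p136536, P p136706, W1 p143461, W2 p143387, W3 p145312,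
W4 p143191, Σ p140739, Θ p140751, Π p141689 (W1–W4 and Σ/Θ/Π are tools for G1's prover; they no longer appear as
hypotheses).
-/

noncomputable section

namespace Summit.QuantumFields.QCD.Cruxes.ExtinctionBuildsQCD.BlockAwayTheSign

open scoped BigOperators Topology Classical MeasureTheory Matrix
open Filter MeasureTheory Matrix
open Literature.MathematicalPhysics.QuantumLattice Literature.MathematicalPhysics.AQFT
  Literature.MathematicalPhysics.QuantumFieldTheory Literature.Probability.LatticeModels
open Literature.Barriers.QuantumFields.WilsonDeterminant
open Summit.QuantumFields.QCD.Theses.SpectralDefectExtinction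
open Summit.QuantumFields.QCD.Theses

/-! ## §0 Vocabulary of the reshape (skeleton-local definitions — verbatim projections of the node and of
the registered stubs; to be filed as a `…Defs` proposal when G1/G36/T come within reach) -/

/-- The honest all-antiperiodic SEA WEIGHT of the witness `reg` at the tuple `m`, step `k`, torus side `2S+1`:
`w_{k,S}(U) = exp(−β_k S_W(U)) · Re ∏_f det D_W^{AP}(U, m_f(k))` (the weight of Σ/Θ/Π; signed, real). -/
def seaWeightAP {Nf : ℕ} (reg : QCDRegularisation Nf) (m : Fin Nf → ℝ) (k S : ℕ)
    (U : GaugeConfig 4 (2 * S + 1) SU3) : ℝ :=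
  Real.exp (-(reg.β k * wilsonAction (fundamentalRep (Fin 3)) U)) *
    (∏ fl : Fin Nf, fermionDet (Literature.MathematicalPhysics.QuantumLattice.wilsonDiracAP U
      (reg.mcrit k + reg.a k * m fl / reg.Zm k))).re

/-- The honest all-antiperiodic FUNCTIONAL `E_{k,S} h = ∫ h·Re∏_f det D_W^{AP}(m_f(k)) dμ_W / ∫ Re∏_f det D_W^{AP}(m_f(k)) dμ_W`
(the `E` pinned by the defining equation in C′/T). -/
def honestExpectAP {Nf : ℕ} (reg : QCDRegularisation Nf) (m : Fin Nf → ℝ) (k S : ℕ)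
    (h : GaugeConfig 4 (2 * S + 1) SU3 → ℝ) : ℝ :=
  (∫ (U : GaugeConfig 4 (2 * S + 1) SU3), h U * (∏ fl : Fin Nf, fermionDet
      (Literature.MathematicalPhysics.QuantumLattice.wilsonDiracAP U (reg.mcrit k + reg.a k * m fl / reg.Zm k))).re
        ∂(wilsonMeasure (fundamentalRep (Fin 3)) (reg.β k))) /
    ∫ (U : GaugeConfig 4 (2 * S + 1) SU3), (∏ fl : Fin Nf, fermionDet
      (Literature.MathematicalPhysics.QuantumLattice.wilsonDiracAP U (reg.mcrit k + reg.a k * m fl / reg.Zm k))).re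
        ∂(wilsonMeasure (fundamentalRep (Fin 3)) (reg.β k))

/-- Side of the BLOCK torus at step `k`, fine side `2S+1`, block scale `ℓ₀`: `⌊(2S+1)/b_k⌋ − 1 + 1` with `b_k = ⌊ℓ₀/a_k⌋`
(verbatim the node's `M k S`; the `−1+1` keeps `NeZero`). -/
abbrev Mside (a : ℕ → ℝ) (ℓ₀ : ℝ) (k S : ℕ) : ℕ := (2 * S + 1) / ⌊ℓ₀ / a k⌋₊ - 1 + 1

/-- The node's corner map `cor k S : Site 4 (M k S) → Site 4 (2S+1)` (evenly spread block corners), verbatim. -/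
abbrev corner (a : ℕ → ℝ) (ℓ₀ : ℝ) (k S : ℕ) (y : Site 4 (Mside a ℓ₀ k S)) : Site 4 (2 * S + 1) :=
  fun i => (((2 * S + 1) * (y i).val / Mside a ℓ₀ k S : ℕ) : ZMod (2 * S + 1))

/-- **`AdmissibleAt` — the node's admissibility predicate `AdmAt w βe Bl k S` (stmt-17812 rev 3), VERBATIM with its
`let`s inlined**, for a general family of fine-torus weights `w`, block couplings `βe` and blockings `Bl`, format
constants `(ε, r, B₀, κ, c₀, cA, A₀)`, lattice spacings `a` and block scale `ℓ₀`: `w_{k,S}` measurable with positive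
Haar integral, gauge / translation / time-reflection / axis-permutation invariant and reflection positive; `Bl_{k,S}`
measurable, covariant, `5b_k`-local; and the COERCIVE FORMAT identity
`∫ G(Bl U) w(U) dU = ∫ G(V) e^{−βe_k A(V) − W(V)} F(LF_ε V, V) dV` with `A` quasi-local analytic coercive, `W` sup-small
analytic, `F` the rough-region set-function. -/
def AdmissibleAt (ε r B₀ κ c₀ cA A₀ : ℝ) (a : ℕ → ℝ) (ℓ₀ : ℝ)
    (w : (k S : ℕ) → GaugeConfig 4 (2 * S + 1) SU3 → ℝ) (βe : ℕ → ℝ)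
    (Bl : (k S : ℕ) → GaugeConfig 4 (2 * S + 1) SU3 → GaugeConfig 4 (Mside a ℓ₀ k S) SU3) (k S : ℕ) : Prop :=
  Measurable (w k S) ∧ (0 < ∫ U, w k S U ∂(Measure.pi fun _ => haarProbability SU3)) ∧
  (∀ g U, w k S (gaugeTransform g U) = w k S U) ∧ (∀ v U, w k S (torusConfigShift v U) = w k S U) ∧
  (∀ U, w k S (GaugeConfig.timeReflect U) = w k S U) ∧
  (∀ (π : Equiv.Perm (Fin 4)) U, w k S (U ∘ fun e => (e.1 ∘ π, π.symm e.2)) = w k S U) ∧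
  (∀ F : GaugeConfig 4 (2 * S + 1) SU3 → ℝ, Measurable F → (∃ C, ∀ U, |F U| ≤ C) → IsPositiveTimeObservable F →
    0 ≤ ∫ U, F (GaugeConfig.timeReflect U) * F U * w k S U ∂(Measure.pi fun _ => haarProbability SU3)) ∧
  Measurable (Bl k S) ∧
  (∀ g U, Bl k S (gaugeTransform g U) = gaugeTransform (g ∘ corner a ℓ₀ k S) (Bl k S U)) ∧
  (∀ e, DependsOn (fun U => Bl k S U e)
    {e' | ∀ i, (e'.1 i - corner a ℓ₀ k S e.1 i).val ≤ 5 * ⌊ℓ₀ / a k⌋₊ ∨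
      (corner a ℓ₀ k S e.1 i - e'.1 i).val ≤ 5 * ⌊ℓ₀ / a k⌋₊}) ∧
  ∃ (A W : QuasiLocalGaugePerturbation 4 (Mside a ℓ₀ k S) SU3 1)
    (F : Finset (Site 4 (Mside a ℓ₀ k S)) → GaugeConfig 4 (Mside a ℓ₀ k S) SU3 → ℝ),
    A.HasAnalyticNormLE (fundamentalRep (Fin 3)) (smallFieldDomain (fundamentalRep (Fin 3)) 1 r ε) κ A₀ ∧
    A.NormLE κ A₀ ∧
    (∀ X ∈ polymers 1, (∃ V, A.act X V ≠ 0) → ∀ y ∈ X, ∀ y' ∈ X, ∀ i,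
      (y i - y' i).val ≤ X.card ∨ (y' i - y i).val ≤ X.card) ∧
    (∀ V, cA * wilsonAction (fundamentalRep (Fin 3)) V ≤ A.total V - A.total fun _ => 1) ∧
    W.HasAnalyticNormLE (fundamentalRep (Fin 3)) (smallFieldDomain (fundamentalRep (Fin 3)) 1 r ε) κ B₀ ∧
    W.NormLE κ B₀ ∧
    (∀ X ∈ polymers 1, (∃ V, W.act X V ≠ 0) → ∀ y ∈ X, ∀ y' ∈ X, ∀ i,
      (y i - y' i).val ≤ X.card ∨ (y' i - y i).val ≤ X.card) ∧
    (∀ Z, Measurable (F Z)) ∧ (∀ V, F ∅ V = 1) ∧ (∀ Z V, |F Z V| ≤ Real.exp (c₀ * Z.card)) ∧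
    (∀ Z (n : ℕ) V V', (∀ e, (∃ y ∈ Z, ∀ i, (e.1 i - y i).val ≤ n ∨ (y i - e.1 i).val ≤ n) → V e = V' e) →
      |F Z V - F Z V'| ≤ Real.exp (c₀ * Z.card + κ * (4 - n))) ∧
    (∀ Z₁ Z₂ (n : ℕ), (∀ y ∈ Z₁, ∀ y' ∈ Z₂, ∃ i, n < (y i - y' i).val ∧ n < (y' i - y i).val) →
      ∀ V, |F (Z₁ ∪ Z₂) V - F Z₁ V * F Z₂ V| ≤ Real.exp (c₀ * (Z₁.card + Z₂.card) + κ * (4 - n))) ∧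
    ∀ Gf, Measurable Gf → (∃ C, ∀ V, |Gf V| ≤ C) →
      ∫ U, Gf (Bl k S U) * w k S U ∂(Measure.pi fun _ => haarProbability SU3) =
        ∫ V, Gf V * (Real.exp (-(βe k * A.total V) - W.total V) *
          F (Finset.univ.filter fun y => ∃ i j : Fin 4,
            ε < 3 - ((fundamentalRep (Fin 3)) (plaquetteHolonomy V y i j)).trace.re) V)
          ∂(Measure.pi fun _ => haarProbability SU3)



/-- **`AdmissiblePosAt` — `AdmissibleAt` WITH FORMAT-LEVEL POSITIVITY `∀ Z V, 0 ≤ F Z V`** (the rough-region factor, hence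
the whole blocked density `e^{−βe A − W}·F(LF V, V)`, is NON-NEGATIVE: the `Bl`-push-forward of the fine weight is a genuine
measure on coarse fields).  This is the disprover's line-compatible repair (ii) of the node (Disproof §8a, 2026-08-17T08:30Z:
rev 3's sup-normed conclusion fails, on paper, for admissible members whose blocked density changes sign with positive
activity — average-sign extensivity), and it is verbatim the card's thesis "block away the sign" turned into the membership
condition: the honest SIGNED sea weight is a usable member iff its blocked density is non-negative.  One conjunct more than
`AdmissibleAt`, inserted after `F ∅ V = 1`. -/
def AdmissiblePosAt (ε r B₀ κ c₀ cA A₀ : ℝ) (a : ℕ → ℝ) (ℓ₀ : ℝ)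
    (w : (k S : ℕ) → GaugeConfig 4 (2 * S + 1) SU3 → ℝ) (βe : ℕ → ℝ)
    (Bl : (k S : ℕ) → GaugeConfig 4 (2 * S + 1) SU3 → GaugeConfig 4 (Mside a ℓ₀ k S) SU3) (k S : ℕ) : Prop :=
  Measurable (w k S) ∧ (0 < ∫ U, w k S U ∂(Measure.pi fun _ => haarProbability SU3)) ∧
  (∀ g U, w k S (gaugeTransform g U) = w k S U) ∧ (∀ v U, w k S (torusConfigShift v U) = w k S U) ∧
  (∀ U, w k S (GaugeConfig.timeReflect U) = w k S U) ∧
  (∀ (π : Equiv.Perm (Fin 4)) U, w k S (U ∘ fun e => (e.1 ∘ π, π.symm e.2)) = w k S U) ∧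
  (∀ F : GaugeConfig 4 (2 * S + 1) SU3 → ℝ, Measurable F → (∃ C, ∀ U, |F U| ≤ C) → IsPositiveTimeObservable F →
    0 ≤ ∫ U, F (GaugeConfig.timeReflect U) * F U * w k S U ∂(Measure.pi fun _ => haarProbability SU3)) ∧
  Measurable (Bl k S) ∧
  (∀ g U, Bl k S (gaugeTransform g U) = gaugeTransform (g ∘ corner a ℓ₀ k S) (Bl k S U)) ∧
  (∀ e, DependsOn (fun U => Bl k S U e)
    {e' | ∀ i, (e'.1 i - corner a ℓ₀ k S e.1 i).val ≤ 5 * ⌊ℓ₀ / a k⌋₊ ∨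
      (corner a ℓ₀ k S e.1 i - e'.1 i).val ≤ 5 * ⌊ℓ₀ / a k⌋₊}) ∧
  ∃ (A W : QuasiLocalGaugePerturbation 4 (Mside a ℓ₀ k S) SU3 1)
    (F : Finset (Site 4 (Mside a ℓ₀ k S)) → GaugeConfig 4 (Mside a ℓ₀ k S) SU3 → ℝ),
    A.HasAnalyticNormLE (fundamentalRep (Fin 3)) (smallFieldDomain (fundamentalRep (Fin 3)) 1 r ε) κ A₀ ∧
    A.NormLE κ A₀ ∧
    (∀ X ∈ polymers 1, (∃ V, A.act X V ≠ 0) → ∀ y ∈ X, ∀ y' ∈ X, ∀ i,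
      (y i - y' i).val ≤ X.card ∨ (y' i - y i).val ≤ X.card) ∧
    (∀ V, cA * wilsonAction (fundamentalRep (Fin 3)) V ≤ A.total V - A.total fun _ => 1) ∧
    W.HasAnalyticNormLE (fundamentalRep (Fin 3)) (smallFieldDomain (fundamentalRep (Fin 3)) 1 r ε) κ B₀ ∧
    W.NormLE κ B₀ ∧
    (∀ X ∈ polymers 1, (∃ V, W.act X V ≠ 0) → ∀ y ∈ X, ∀ y' ∈ X, ∀ i,
      (y i - y' i).val ≤ X.card ∨ (y' i - y i).val ≤ X.card) ∧
    (∀ Z, Measurable (F Z)) ∧ (∀ V, F ∅ V = 1) ∧ (∀ Z V, 0 ≤ F Z V) ∧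
    (∀ Z V, |F Z V| ≤ Real.exp (c₀ * Z.card)) ∧
    (∀ Z (n : ℕ) V V', (∀ e, (∃ y ∈ Z, ∀ i, (e.1 i - y i).val ≤ n ∨ (y i - e.1 i).val ≤ n) → V e = V' e) →
      |F Z V - F Z V'| ≤ Real.exp (c₀ * Z.card + κ * (4 - n))) ∧
    (∀ Z₁ Z₂ (n : ℕ), (∀ y ∈ Z₁, ∀ y' ∈ Z₂, ∃ i, n < (y i - y' i).val ∧ n < (y' i - y i).val) →
      ∀ V, |F (Z₁ ∪ Z₂) V - F Z₁ V * F Z₂ V| ≤ Real.exp (c₀ * (Z₁.card + Z₂.card) + κ * (4 - n))) ∧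
    ∀ Gf, Measurable Gf → (∃ C, ∀ V, |Gf V| ≤ C) →
      ∫ U, Gf (Bl k S U) * w k S U ∂(Measure.pi fun _ => haarProbability SU3) =
        ∫ V, Gf V * (Real.exp (-(βe k * A.total V) - W.total V) *
          F (Finset.univ.filter fun y => ∃ i j : Fin 4,
            ε < 3 - ((fundamentalRep (Fin 3)) (plaquetteHolonomy V y i j)).trace.re) V)
          ∂(Measure.pi fun _ => haarProbability SU3)



/-- **`FineClausesAt w k S` — the seven FINE clauses of `AdmissiblePosAt`** (measurability, positive partition function, gauge /
translation / time-reflection / axis-permutation invariance, reflection positivity of the fine weight `w_{k,S}`).  For the honest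
sea weight these are the LANDED Σ/Θ/Π (`fineClausesAt_seaWeightAP` below). -/
def FineClausesAt (w : (k S : ℕ) → GaugeConfig 4 (2 * S + 1) SU3 → ℝ) (k S : ℕ) : Prop :=
  Measurable (w k S) ∧ (0 < ∫ U, w k S U ∂(Measure.pi fun _ => haarProbability SU3)) ∧
  (∀ g U, w k S (gaugeTransform g U) = w k S U) ∧ (∀ v U, w k S (torusConfigShift v U) = w k S U) ∧
  (∀ U, w k S (GaugeConfig.timeReflect U) = w k S U) ∧
  (∀ (π : Equiv.Perm (Fin 4)) U, w k S (U ∘ fun e => (e.1 ∘ π, π.symm e.2)) = w k S U) ∧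
  (∀ F : GaugeConfig 4 (2 * S + 1) SU3 → ℝ, Measurable F → (∃ C, ∀ U, |F U| ≤ C) → IsPositiveTimeObservable F →
    0 ≤ ∫ U, F (GaugeConfig.timeReflect U) * F U * w k S U ∂(Measure.pi fun _ => haarProbability SU3))

/-- **`BlockFormatPosAt … a ℓ₀ w βe Bl k S` — the BLOCK clauses of `AdmissiblePosAt`**: the blocking `Bl_{k,S}` is measurable,
covariant and `5b_k`-local, and the `Bl`-push-forward of `w_{k,S} dU` is in the COERCIVE FORMAT with a NON-NEGATIVE rough-region factor
(`e^{−βe_k A − W}·F(LF_ε ·, ·)`, `A` quasi-local analytic coercive, `W` sup-small analytic, `F ≥ 0` rough) — exactly the OPEN content of G1. -/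
def BlockFormatPosAt (ε r B₀ κ c₀ cA A₀ : ℝ) (a : ℕ → ℝ) (ℓ₀ : ℝ)
    (w : (k S : ℕ) → GaugeConfig 4 (2 * S + 1) SU3 → ℝ) (βe : ℕ → ℝ)
    (Bl : (k S : ℕ) → GaugeConfig 4 (2 * S + 1) SU3 → GaugeConfig 4 (Mside a ℓ₀ k S) SU3) (k S : ℕ) : Prop :=
  Measurable (Bl k S) ∧
  (∀ g U, Bl k S (gaugeTransform g U) = gaugeTransform (g ∘ corner a ℓ₀ k S) (Bl k S U)) ∧
  (∀ e, DependsOn (fun U => Bl k S U e)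
    {e' | ∀ i, (e'.1 i - corner a ℓ₀ k S e.1 i).val ≤ 5 * ⌊ℓ₀ / a k⌋₊ ∨
      (corner a ℓ₀ k S e.1 i - e'.1 i).val ≤ 5 * ⌊ℓ₀ / a k⌋₊}) ∧
  ∃ (A W : QuasiLocalGaugePerturbation 4 (Mside a ℓ₀ k S) SU3 1)
    (F : Finset (Site 4 (Mside a ℓ₀ k S)) → GaugeConfig 4 (Mside a ℓ₀ k S) SU3 → ℝ),
    A.HasAnalyticNormLE (fundamentalRep (Fin 3)) (smallFieldDomain (fundamentalRep (Fin 3)) 1 r ε) κ A₀ ∧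
    A.NormLE κ A₀ ∧
    (∀ X ∈ polymers 1, (∃ V, A.act X V ≠ 0) → ∀ y ∈ X, ∀ y' ∈ X, ∀ i,
      (y i - y' i).val ≤ X.card ∨ (y' i - y i).val ≤ X.card) ∧
    (∀ V, cA * wilsonAction (fundamentalRep (Fin 3)) V ≤ A.total V - A.total fun _ => 1) ∧
    W.HasAnalyticNormLE (fundamentalRep (Fin 3)) (smallFieldDomain (fundamentalRep (Fin 3)) 1 r ε) κ B₀ ∧
    W.NormLE κ B₀ ∧
    (∀ X ∈ polymers 1, (∃ V, W.act X V ≠ 0) → ∀ y ∈ X, ∀ y' ∈ X, ∀ i,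
      (y i - y' i).val ≤ X.card ∨ (y' i - y i).val ≤ X.card) ∧
    (∀ Z, Measurable (F Z)) ∧ (∀ V, F ∅ V = 1) ∧ (∀ Z V, 0 ≤ F Z V) ∧
    (∀ Z V, |F Z V| ≤ Real.exp (c₀ * Z.card)) ∧
    (∀ Z (n : ℕ) V V', (∀ e, (∃ y ∈ Z, ∀ i, (e.1 i - y i).val ≤ n ∨ (y i - e.1 i).val ≤ n) → V e = V' e) →
      |F Z V - F Z V'| ≤ Real.exp (c₀ * Z.card + κ * (4 - n))) ∧
    (∀ Z₁ Z₂ (n : ℕ), (∀ y ∈ Z₁, ∀ y' ∈ Z₂, ∃ i, n < (y i - y' i).val ∧ n < (y' i - y i).val) →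
      ∀ V, |F (Z₁ ∪ Z₂) V - F Z₁ V * F Z₂ V| ≤ Real.exp (c₀ * (Z₁.card + Z₂.card) + κ * (4 - n))) ∧
    ∀ Gf, Measurable Gf → (∃ C, ∀ V, |Gf V| ≤ C) →
      ∫ U, Gf (Bl k S U) * w k S U ∂(Measure.pi fun _ => haarProbability SU3) =
        ∫ V, Gf V * (Real.exp (-(βe k * A.total V) - W.total V) *
          F (Finset.univ.filter fun y => ∃ i j : Fin 4,
            ε < 3 - ((fundamentalRep (Fin 3)) (plaquetteHolonomy V y i j)).trace.re) V)
          ∂(Measure.pi fun _ => haarProbability SU3)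


/-- Fine clauses + block-format clauses = positive-format admissibility (repacking). -/
theorem admissiblePosAt_of {ε r B₀ κ c₀ cA A₀ : ℝ} {a : ℕ → ℝ} {ℓ₀ : ℝ}
    {w : (k S : ℕ) → GaugeConfig 4 (2 * S + 1) SU3 → ℝ} {βe : ℕ → ℝ}
    {Bl : (k S : ℕ) → GaugeConfig 4 (2 * S + 1) SU3 → GaugeConfig 4 (Mside a ℓ₀ k S) SU3} {k S : ℕ}
    (hf : FineClausesAt w k S) (hb : BlockFormatPosAt ε r B₀ κ c₀ cA A₀ a ℓ₀ w βe Bl k S) :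
    AdmissiblePosAt ε r B₀ κ c₀ cA A₀ a ℓ₀ w βe Bl k S := by
  obtain ⟨h1, h2, h3, h4, h5, h6, h7⟩ := hf
  obtain ⟨h8, h9, h10, hfmt⟩ := hb
  exact ⟨h1, h2, h3, h4, h5, h6, h7, h8, h9, h10, hfmt⟩

/-- Format-level positivity is an extra conjunct: `AdmissiblePosAt → AdmissibleAt` (projection). -/
theorem AdmissiblePosAt.toAdmissibleAt {ε r B₀ κ c₀ cA A₀ : ℝ} {a : ℕ → ℝ} {ℓ₀ : ℝ}
    {w : (k S : ℕ) → GaugeConfig 4 (2 * S + 1) SU3 → ℝ} {βe : ℕ → ℝ}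
    {Bl : (k S : ℕ) → GaugeConfig 4 (2 * S + 1) SU3 → GaugeConfig 4 (Mside a ℓ₀ k S) SU3} {k S : ℕ}
    (h : AdmissiblePosAt ε r B₀ κ c₀ cA A₀ a ℓ₀ w βe Bl k S) : AdmissibleAt ε r B₀ κ c₀ cA A₀ a ℓ₀ w βe Bl k S := by
  obtain ⟨h1, h2, h3, h4, h5, h6, h7, h8, h9, h10, A, W, F, i1, i2, i3, i4, i5, i6, i7, i8, i9, -, i10, i11, i12, i13⟩ := h
  exact ⟨h1, h2, h3, h4, h5, h6, h7, h8, h9, h10, A, W, F, i1, i2, i3, i4, i5, i6, i7, i8, i9, i10, i11, i12, i13⟩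

/-- **`RobustYangMillsRGNode` — the named node `HeavyThresholdYMBridge.RobustYangMillsRG` (item stmt-QuantumFields-17812,
rev 3, 2026-08-17T02:12Z), VERBATIM with its `let`s inlined** (`G ↦ SU3`, `ρ ↦ fundamentalRep (Fin 3)`, `b, N, M, cor,
μ, LF, AdmAt, E` expanded; `AdmAt ↦ AdmissibleAt`).  WHY RESTATED AND NOT IMPORTED: the Lean farm has served a STALE olean
of `Summits.QuantumFields.QCD.Theses.HeavyThresholdYMBridge` since the rev-3 restatement (rev-2 arity: five format
constants, not seven — finding F4 of crux 18031's lead, reproduced by this seat's probe 07:40Z), and the crux-write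
verifier refuses every file importing that module as `incoherent … mismatch` (why c0/c1 could never publish this
skeleton).  Against a coherent build, `RobustYangMillsRGNode ↔ HeavyThresholdYMBridge.RobustYangMillsRG` holds by
`Iff.rfl` (ζ/δ only); Stub R below is that item BY THIS NAME.  Coercive-format robustness of the gapped phase at ONE
block scale: for all format constants there is `β₀` such that, over any scaling data `(a, L)` and block scale `ℓ₀`,
every admissible `(w, βe, Bl)` (from `β₀` on, eventually in `k`, all `S ≥ L_k`) has uniformly clustering blocked laws
of the Haar-ratio functional `h ↦ ∫ h w dU / ∫ w dU` in time slabs, at a rate `Δ ℓ₀` per block step. -/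
def RobustYangMillsRGNode : Prop :=
  ∀ ε r B₀ κ c₀ cA A₀ : ℝ, 0 < ε → 0 < r → 0 < B₀ → 0 < κ → 0 < c₀ → 0 < cA → 0 < A₀ →
    ∃ β₀ : ℝ, 0 < β₀ ∧ ∀ (a : ℕ → ℝ) (L : ℕ → ℕ), (∀ k, 0 < a k) → Tendsto a atTop (𝓝 0) →
      Tendsto (fun k => a k * L k) atTop atTop → ∀ ℓ₀ : ℝ, 0 < ℓ₀ →
      ∀ (w : (k S : ℕ) → GaugeConfig 4 (2 * S + 1) SU3 → ℝ) (βe : ℕ → ℝ)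
        (Bl : (k S : ℕ) → GaugeConfig 4 (2 * S + 1) SU3 → GaugeConfig 4 (Mside a ℓ₀ k S) SU3),
        (∃ βl, Tendsto βe atTop (𝓝 βl)) →
        (∀ᶠ k in atTop, β₀ ≤ βe k ∧ ∀ S, L k ≤ S → AdmissibleAt ε r B₀ κ c₀ cA A₀ a ℓ₀ w βe Bl k S) →
        ∃ Δ : ℝ, 0 < Δ ∧ ∀ hgt : ℕ, ∃ C : ℝ, ∀ᶠ k in atTop, ∀ S, L k ≤ S →
          ∀ (t : ℕ) (G₁ G₂ : GaugeConfig 4 (Mside a ℓ₀ k S) SU3 → ℝ) (C₁ C₂ : ℝ), 2 * t ≤ Mside a ℓ₀ k S →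
          Measurable G₁ → Measurable G₂ → (∀ V, |G₁ V| ≤ C₁) → (∀ V, |G₂ V| ≤ C₂) →
          DependsOn G₁ {e | (e.1 0).val < hgt} → DependsOn G₂ {e | (e.1 0).val < hgt} →
          |(∫ U, G₁ (Bl k S U) *
                G₂ (torusConfigShift (Pi.single 0 (t : ZMod (Mside a ℓ₀ k S))) (Bl k S U)) * w k S U
                ∂(Measure.pi fun _ => haarProbability SU3)) /
              (∫ U, w k S U ∂(Measure.pi fun _ => haarProbability SU3)) -
            (∫ U, G₁ (Bl k S U) * w k S U ∂(Measure.pi fun _ => haarProbability SU3)) /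
                (∫ U, w k S U ∂(Measure.pi fun _ => haarProbability SU3)) *
              ((∫ U, G₂ (torusConfigShift (Pi.single 0 (t : ZMod (Mside a ℓ₀ k S))) (Bl k S U)) *
                  w k S U ∂(Measure.pi fun _ => haarProbability SU3)) /
                (∫ U, w k S U ∂(Measure.pi fun _ => haarProbability SU3)))| ≤
            C * C₁ * C₂ * Real.exp (-(Δ * (ℓ₀ * t)))


/-- **`RobustYangMillsRGPosNode` — the node restricted to POSITIVE-FORMAT members** (`AdmissiblePosAt` in place of
`AdmissibleAt`; otherwise verbatim rev 3).  It is IMPLIED by the node as filed (`robustPos_of_robust`, a smaller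
hypothesis class), it is immune to the average-sign-extensivity counterexample of Disproof §8a (a non-negative blocked
density gives a probability expectation on block observables, `|E h| ≤ sup|h|`), and it is what this line consumes:
Stub R below.  If stmt-17812 is repaired by inserting format-level positivity into `AdmAt` (the disprover's option (ii)),
this IS the repaired node verbatim; if repaired by `w ≥ 0` (option (a)) the line is dead by fiat; if by OS-normed
constants (option (b)) Stub R must be re-pointed. -/
def RobustYangMillsRGPosNode : Prop :=
  ∀ ε r B₀ κ c₀ cA A₀ : ℝ, 0 < ε → 0 < r → 0 < B₀ → 0 < κ → 0 < c₀ → 0 < cA → 0 < A₀ →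
    ∃ β₀ : ℝ, 0 < β₀ ∧ ∀ (a : ℕ → ℝ) (L : ℕ → ℕ), (∀ k, 0 < a k) → Tendsto a atTop (𝓝 0) →
      Tendsto (fun k => a k * L k) atTop atTop → ∀ ℓ₀ : ℝ, 0 < ℓ₀ →
      ∀ (w : (k S : ℕ) → GaugeConfig 4 (2 * S + 1) SU3 → ℝ) (βe : ℕ → ℝ)
        (Bl : (k S : ℕ) → GaugeConfig 4 (2 * S + 1) SU3 → GaugeConfig 4 (Mside a ℓ₀ k S) SU3),
        (∃ βl, Tendsto βe atTop (𝓝 βl)) →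
        (∀ᶠ k in atTop, β₀ ≤ βe k ∧ ∀ S, L k ≤ S → AdmissiblePosAt ε r B₀ κ c₀ cA A₀ a ℓ₀ w βe Bl k S) →
        ∃ Δ : ℝ, 0 < Δ ∧ ∀ hgt : ℕ, ∃ C : ℝ, ∀ᶠ k in atTop, ∀ S, L k ≤ S →
          ∀ (t : ℕ) (G₁ G₂ : GaugeConfig 4 (Mside a ℓ₀ k S) SU3 → ℝ) (C₁ C₂ : ℝ), 2 * t ≤ Mside a ℓ₀ k S →
          Measurable G₁ → Measurable G₂ → (∀ V, |G₁ V| ≤ C₁) → (∀ V, |G₂ V| ≤ C₂) →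
          DependsOn G₁ {e | (e.1 0).val < hgt} → DependsOn G₂ {e | (e.1 0).val < hgt} →
          |(∫ U, G₁ (Bl k S U) *
                G₂ (torusConfigShift (Pi.single 0 (t : ZMod (Mside a ℓ₀ k S))) (Bl k S U)) * w k S U
                ∂(Measure.pi fun _ => haarProbability SU3)) /
              (∫ U, w k S U ∂(Measure.pi fun _ => haarProbability SU3)) -
            (∫ U, G₁ (Bl k S U) * w k S U ∂(Measure.pi fun _ => haarProbability SU3)) /
                (∫ U, w k S U ∂(Measure.pi fun _ => haarProbability SU3)) *
              ((∫ U, G₂ (torusConfigShift (Pi.single 0 (t : ZMod (Mside a ℓ₀ k S))) (Bl k S U)) *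
                  w k S U ∂(Measure.pi fun _ => haarProbability SU3)) /
                (∫ U, w k S U ∂(Measure.pi fun _ => haarProbability SU3)))| ≤
            C * C₁ * C₂ * Real.exp (-(Δ * (ℓ₀ * t)))

/-- The node as filed (rev 3) implies its positive-format restriction (hypothesis class shrinks). -/
theorem robustPos_of_robust (h : RobustYangMillsRGNode) : RobustYangMillsRGPosNode := by
  intro ε r B₀ κ c₀ cA A₀ hε hr hB₀ hκ hc₀ hcA hA₀
  obtain ⟨β₀, hβ₀, H⟩ := h ε r B₀ κ c₀ cA A₀ hε hr hB₀ hκ hc₀ hcA hA₀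
  refine ⟨β₀, hβ₀, fun a L ha ha₀ haL ℓ₀ hℓ₀ w βe Bl hconv hadm => ?_⟩
  exact H a L ha ha₀ haL ℓ₀ hℓ₀ w βe Bl hconv
    (hadm.mono fun k hk => ⟨hk.1, fun S hS => (hk.2 S hS).toAdmissibleAt⟩)

/-- **`BlockClusteringAt` — the node's CONCLUSION read for the honest functional**: uniform time-slab clustering of the
blocked laws of `honestExpectAP reg m` at block scale `ℓ₀` with rate `Δ` (verbatim the node's `∃Δ`-body at fixed `Δ`,
with its `E` replaced by `honestExpectAP reg m` — the two agree by G2b). -/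
def BlockClusteringAt {Nf : ℕ} (reg : QCDRegularisation Nf) (m : Fin Nf → ℝ) (ℓ₀ : ℝ)
    (Bl : (k S : ℕ) → GaugeConfig 4 (2 * S + 1) SU3 → GaugeConfig 4 (Mside reg.a ℓ₀ k S) SU3) (Δ : ℝ) : Prop :=
  ∀ hgt : ℕ, ∃ C : ℝ, ∀ᶠ k in atTop, ∀ S, reg.L k ≤ S →
    ∀ (t : ℕ) (G₁ G₂ : GaugeConfig 4 (Mside reg.a ℓ₀ k S) SU3 → ℝ) (C₁ C₂ : ℝ), 2 * t ≤ Mside reg.a ℓ₀ k S →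
      Measurable G₁ → Measurable G₂ → (∀ V, |G₁ V| ≤ C₁) → (∀ V, |G₂ V| ≤ C₂) →
      DependsOn G₁ {e | (e.1 0).val < hgt} → DependsOn G₂ {e | (e.1 0).val < hgt} →
      |honestExpectAP reg m k S (fun U => G₁ (Bl k S U) *
            G₂ (torusConfigShift (Pi.single 0 (t : ZMod (Mside reg.a ℓ₀ k S))) (Bl k S U))) -
          honestExpectAP reg m k S (fun U => G₁ (Bl k S U)) *
            honestExpectAP reg m k S (fun U =>
              G₂ (torusConfigShift (Pi.single 0 (t : ZMod (Mside reg.a ℓ₀ k S))) (Bl k S U)))| ≤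
        C * C₁ * C₂ * Real.exp (-(Δ * (ℓ₀ * t)))

/-- **`SDPlusWitness` — the data an SD⁺ witness hands the line** (scalings, cap, branch, and EXTINCT ∧ TIGHT⁺ above `M₀`
in the phase-quenched reading `qcdPhaseQuenchedExpect`; verbatim the hypothesis block of C′). -/
def SDPlusWitness (Nf : ℕ) (reg : QCDRegularisation Nf) (M₀ c : ℝ) : Prop :=
  reg.HasMassScaling ∧ (reg.scheme 0 0 0).HasAsymptoticScaling ∧
  (∃ p : ℕ, ∀ᶠ k in atTop, (reg.L k : ℝ) ≤ (reg.a k)⁻¹ ^ p) ∧ (∀ᶠ k in atTop, -1 < reg.mcrit k) ∧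
  ∀ m : Fin Nf → ℝ, (∀ f, M₀ < m f) → (∀ ε : ℝ, 0 < ε → ∀ᶠ k in atTop, ∀ S : ℕ, reg.L k ≤ S → qcdPhaseQuenchedExpect (reg.β k) (2 * S + 1) (fun f => reg.mcrit k + reg.a k * m f / reg.Zm k) (fun U => ∑ f : Fin Nf, ((Multiset.countP (fun z : ℂ => z.im = 0 ∧ z.re < -(reg.mcrit k + reg.a k * m f / reg.Zm k)) (wilsonDirac (fundamentalRep (Fin 3)) U 0 1).charpoly.roots : ℝ) + (Multiset.countP (fun z : ℂ => |z.re| < c * (reg.a k * m f / reg.Zm k)) (spinorLift gammaFive * wilsonDirac (fundamentalRep (Fin 3)) U (reg.mcrit k + reg.a k * m f / reg.Zm k) 1).charpoly.roots : ℝ))) ≤ ε * ((2 * S + 1 : ℝ) / (2 * reg.L k + 1)) ^ 4) ∧ (∃ η : ℝ, 0 < η ∧ ∀ M : ℝ, M₀ < M → ∀ᶠ k in atTop, max 1 (η * (reg.a k * (2 * reg.L k + 1 : ℝ)) ^ 2) ≤ qcdPhaseQuenchedExpect (reg.β k) (2 * reg.L k + 1) (fun f => reg.mcrit k + reg.a k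 * m f / reg.Zm k) (fun U => |(Multiset.countP (fun z : ℂ => z.re < 0) (spinorLift gammaFive * wilsonDirac (fundamentalRep (Fin 3)) U (reg.mcrit k - reg.a k * M / reg.Zm k) 1).charpoly.roots : ℝ) - 6 * (2 * reg.L k + 1 : ℝ) ^ 4|))

/-- **`CorePackageAt` — the gluonic OS CORE PACKAGE of the honest functional at the tuple `m`, hereditarily along
subsequences** (verbatim the per-tuple conclusion of C′ = the per-tuple core hypothesis of T). -/
def CorePackageAt {Nf : ℕ} (reg : QCDRegularisation Nf) (m : Fin Nf → ℝ) : Prop :=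
  ∀ ψ : ℕ → ℕ, StrictMono ψ → ∃ φ : ℕ → ℕ, StrictMono φ ∧ ∀ E : (k S : ℕ) → (GaugeConfig 4 (2 * S + 1) SU3 → ℝ) → ℝ, (∀ (k S : ℕ) (h : GaugeConfig 4 (2 * S + 1) SU3 → ℝ), E k S h = (∫ (U : GaugeConfig 4 (2 * S + 1) SU3), h U * (∏ fl : Fin Nf, fermionDet (Literature.MathematicalPhysics.QuantumLattice.wilsonDiracAP U (reg.mcrit k + reg.a k * m fl / reg.Zm k))).re ∂(wilsonMeasure (fundamentalRep (Fin 3)) (reg.β k))) / ∫ (U : GaugeConfig 4 (2 * S + 1) SU3), (∏ fl : Fin Nf, fermionDet (Literature.MathematicalPhysics.QuantumLattice.wilsonDiracAP U (reg.mcrit k + reg.a k * m fl / reg.Zm k))).re ∂(wilsonMeasure (fundamentalRep (Fin 3)) (reg.β k))) → ∃ (cY mY : YMSpecies SU3 → ℕ → ℝ) (T : OSData (YMSpecies SU3) 4) (Δ : ℝ), 0 < Δ ∧ (∀ n : ℕ, n ≠ 0 → ∀ (σ : Fin n → YMSpecies SU3) (f : Fin n → SchwartzMap (EuclideanSpace ℝ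 (Fin 4)) ℝ) (F : SchwartzMap (Fin n → EuclideanSpace ℝ (Fin 4)) ℂ), IsTensorOf F (fun i => ofRealTest (f i)) → IsOffDiagonal F → Tendsto (fun j : ℕ => (E (ψ (φ j)) (reg.L (ψ (φ j))) (fun U => ∏ i, smearedLatticeField (σ i).F (Literature.Probability.LatticeModels.box 4 (reg.L (ψ (φ j)))) (reg.a (ψ (φ j))) (cY (σ i) (ψ (φ j))) (mY (σ i) (ψ (φ j))) (f i) (torusLift (2 * reg.L (ψ (φ j)) + 1) U)) : ℂ)) atTop (𝓝 (T.schwinger n σ F))) ∧ T.IsNontrivial (fundamentalLatticeRep 3).curvature ∧ T.IsNonGaussian (fundamentalLatticeRep 3).curvature ∧ T.HasMassGap Δ ∧ (∀ A B : YMSpecies SU3, ∃ C : ℝ, ∀ᶠ k in atTop, ∀ S : ℕ, reg.L k ≤ S → ∀ n : ℕ, n ≤ S → |E k S (fun U => A.F (torusLift (2 * S + 1) U) * B.F (configShift (-Pi.single 0 (n : ℤ)) (torusLift (2 * S + 1) U))) - E k S (fun U => A.F (torusLift (2 * S + 1) U)) * E k S (fun U => B.F (torusLift (2 * S + 1) U))|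 ≤ C * Real.exp (-(Δ * (reg.a k * n))))

/-! ## §1 The registered stubs -/

/-- **Stub R (`stub_robustYangMillsRG`) — the named node, consumed in POSITIVE-FORMAT form.** Item stmt-QuantumFields-17812
(route HeavyThresholdYMBridge, rev 3: coercive-format robustness of the gapped phase at one block scale), restricted to
positive-format members: `RobustYangMillsRGPosNode` — implied by the node as filed (`robustPos_of_robust` ∘ the let-free
verbatim restatement `RobustYangMillsRGNode`; by-name import blocked by the stale farm olean, see that docstring), and equal
to the node after the disprover's repair (ii) of its standing `refuted-misstated` verdict (Disproof §8a). Not this line's to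
prove; `blocked-on: stmt-QuantumFields-17812` (repair pending). -/
theorem stub_robustYangMillsRG : RobustYangMillsRGPosNode := by
  sorry

/-- **Stub G1 (`stub_seaBlockFormat`) — SEA BLOCK FORMAT (OPEN-PROBLEM; the crux-specific content of the line).**
For an SD⁺ witness `(reg, M₀, c)` at `N_f ∈ {2,3}` there are format constants `(ε, r, B₀, κ, c₀, cA, A₀) > 0` such that
for EVERY block-coupling threshold `β₀ > 0` there are a mass threshold `M₁ ≥ M₀` and a block scale `ℓ₀ > 0` such that for
every tuple `m > M₁` some convergent block-coupling sequence `βe` and some blocking family `Bl` make the honest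
all-antiperiodic sea weight `seaWeightAP reg m` ADMISSIBLE for the node from `β₀` on, eventually in `k`, on all tori
`S ≥ L_k`.  Content: block-fermion RG with a dynamical `SU(3)` field from `a_k` to `ℓ₀` (Bałaban gauge RG + Gaussian
fermion elimination + random-walk bounds — not in print) landing in the COERCIVE format with `‖W‖ ≤ B₀ = O(1)`; the
line's thesis is that SD⁺ pays for the sea part of `W`: EXTINCT (via E/P) + wells localisation (W3/W4, landed) +
a conditional Harnack step make sign/window defects a conditional MINORITY on small-field block fibres, so the
blocked signed density is positive with margin `½` there (`integral_signed_ge_of_defectFraction`, ideator sketch §2)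
and its logarithm joins `W`.  SINCE v12 THE CONCLUSION IS POSITIVE-FORMAT MEMBERSHIP (`AdmissiblePosAt`, `F ≥ 0`): the
line's REAL core made explicit (Disproof §8a) — BLOCKED POSITIVITY of the honest signed weight, `∀ᶠ k, ∀ S ≥ L_k`, the
`Bl`-push-forward of `e^{−β_k S_W} Re∏_f det D_W^{AP}(m_f(k))` is a non-negative measure on coarse fields (conditional
|det|-minority of sign-defective fine fields on EVERY fibre, rough ones included; NOT implied by EXTINCT, which averages over
fibres; plausible for the honest witness because sign-defect carriers are dislocations at scale `≍ a√β ≪ ℓ₀`, invisible to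
the coarse field).  SINCE v13 THE STUB STATES ONLY THE BLOCK CLAUSES (`BlockFormatPosAt`): the fine clauses 1–7 are ASSEMBLED in the skeleton from the
landed Σ/Θ/Π (`fineClausesAt_seaWeightAP`: BRANCH gives `m_f(k) > −1`, asymptotic scaling `β_k ≥ 0`, `a_k L_k → ∞` gives `L_k ≥ 1`). -/
theorem stub_seaBlockFormat : ∀ {Nf : ℕ}, Nf = 2 ∨ Nf = 3 → ∀ (reg : QCDRegularisation Nf) (M₀ c : ℝ), 0 ≤ M₀ → 0 < c → SDPlusWitness Nf reg M₀ c → ∃ ε r B₀ κ c₀ cA A₀ : ℝ, 0 < ε ∧ 0 < r ∧ 0 < B₀ ∧ 0 < κ ∧ 0 < c₀ ∧ 0 < cA ∧ 0 < A₀ ∧ ∀ β₀ : ℝ, 0 < β₀ → ∃ M₁ : ℝ, M₀ ≤ M₁ ∧ ∃ ℓ₀ : ℝ, 0 < ℓ₀ ∧ ∀ m : Fin Nf → ℝ, (∀ f, M₁ < m f) → ∃ (βe : ℕ → ℝ) (Bl : (k S : ℕ) → GaugeConfig 4 (2 * S + 1) SU3 → GaugeConfig 4 (Mside reg.a ℓ₀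 k S) SU3), (∃ βl : ℝ, Tendsto βe atTop (𝓝 βl)) ∧ ∀ᶠ k in atTop, β₀ ≤ βe k ∧ ∀ S, reg.L k ≤ S → BlockFormatPosAt ε r B₀ κ c₀ cA A₀ reg.a ℓ₀ (seaWeightAP reg m) βe Bl k S := by
  sorry

/-! **G2b (`stub_honestExpectAP_eq_haarRatio`) — LANDED p149139** (wave 1 of lead c2): imported from
`Summits.QuantumFields.QCD.Theorems.SpectralDefectExtinctionExtinctionBuildsQCDStubHonestExpectAPEqHaarRatio`
(same namespace, same name); used below in `blockClusteringAt_of_node`. -/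

/-- **Stub G36 (`stub_coreOfBlockGap`) — the FINE/OS LEG (YM-GRADE; = 18031's KΩ, 14667's fine leg).** For an SD⁺
witness at `N_f ∈ {2,3}`, a tuple `m > M₀`, format data `(ε, r, B₀, κ, c₀, cA, A₀, ℓ₀)`, a convergent block coupling
`βe` and a blocking family `Bl` making `seaWeightAP reg m` admissible eventually, and a rate `Δ > 0` at which the
blocked laws of the honest functional cluster uniformly in time slabs (the node's output): the gluonic OS core package
of the honest functional at `m` (species renormalisations, OS data with n-point convergence along subsequences,
non-trivial non-Gaussian curvature, OS gap, fine gluonic clustering).  Content: fibre decoupling (fine = block +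
fluctuation with uniform control; the block gap is blind below `ℓ₀`, hence the format/SD⁺ data are re-supplied),
transfer-matrix gap from dense clustering, OS limit with E1 = SO(4) restoration, non-triviality from asymptotic
freedom at short distance — no theorem in print for `d = 4` lattice gauge theories. -/
theorem stub_coreOfBlockGap : RobustYangMillsRGPosNode → ∀ {Nf : ℕ}, Nf = 2 ∨ Nf = 3 → ∀ (reg : QCDRegularisation Nf) (M₀ c : ℝ), 0 ≤ M₀ → 0 < c → SDPlusWitness Nf reg M₀ c → ∀ (ε r B₀ κ c₀ cA A₀ ℓ₀ : ℝ), 0 < ε → 0 < r → 0 < B₀ → 0 < κ → 0 < c₀ → 0 < cA → 0 < A₀ → 0 < ℓ₀ → ∀ (m : Fin Nf → ℝ), (∀ f, M₀ < m f) → ∀ (βe : ℕ → ℝ) (Bl : (k S : ℕ) → GaugeConfig 4 (2 * S + 1) SU3 → GaugeConfig 4 (Mside reg.a ℓ₀ k S) SU3), (∃ βl : ℝ, Tendsto βe atTop (𝓝 βl)) → (∀ᶠ k in atTop, ∀ S, reg.L k ≤ S → AdmissiblePosAt ε r B₀ κ c₀ cA A₀ reg.a ℓ₀ (seaWeightAP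 reg m) βe Bl k S) → ∀ Δ : ℝ, 0 < Δ → BlockClusteringAt reg m ℓ₀ Bl Δ → CorePackageAt reg m := by
  sorry

/-- **Stub T (`stub_flavouredThreshold`) — flavoured threshold QCD from the gluonic core package (CRUX-SIZED: X2
per/AP at measure level, X3 flavoured sector incl. the TIGHT⁺-pinned `IsNontrivial (pseudoRe f g)`, X4 flavoured
lattice gap, X5 mass equicontinuity off a countable tuple set; diagonal helper `stub_flavouredThresholdDiagonal`
landed p141234).** From R, the SD⁺ witness data in phase-quenched reading, the positivity of the honest periodic
partition function above `M₀`, and the core package above `M₁ ≥ M₀`: a subsequence `φ` and a restricted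
regularisation `reg' = reg ∘ φ` (same `a, β, L, Z_m`), mass-scaling, with the THR body above some `M₂ ≥ 0`.
Verbatim the v3–v8 registration (R hypothesis re-pointed to `RobustYangMillsRGPosNode`).  CAVEAT (Disproof §8b, landed
`Negative/VolumeFloor.lean` p149644): the spectral per/AP transfer W/F bites at the scheme torus only if
`8π/(2L_k+1) < c a_k m_f/Z_k`, i.e. `a_k(2L_k+1)/Z_k → ∞`, which SD⁺ minus TIGHT⁺ does NOT supply (slow-volume tip family);
X2 must therefore go by massive-propagator locality at rate `a_k m_phys`, or get `ℓ_k/Z_k → ∞` from TIGHT⁺ / an added class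
clause `Tendsto (fun k => reg.a k * reg.L k / reg.Zm k) atTop atTop` (planner). -/
theorem stub_flavouredThreshold : RobustYangMillsRGPosNode → ∀ (Nf : ℕ), Nf = 2 ∨ Nf = 3 → ∀ (reg : QCDRegularisation Nf) (M₀ c : ℝ), 0 ≤ M₀ → 0 < c → reg.HasMassScaling → (reg.scheme 0 0 0).HasAsymptoticScaling → (∀ᶠ k in atTop, -1 < reg.mcrit k) → (∀ m : Fin Nf → ℝ, (∀ f, M₀ < m f) → (∀ ε : ℝ, 0 < ε → ∀ᶠ k in atTop, ∀ S : ℕ, reg.L k ≤ S → qcdPhaseQuenchedExpect (reg.β k) (2 * S + 1) (fun f => reg.mcrit k + reg.a k * m f / reg.Zm k) (fun U => ∑ f : Fin Nf, ((Multiset.countP (fun z : ℂ => z.im = 0 ∧ z.re < -(reg.mcrit k + reg.a k * m f / reg.Zm k)) (wilsonDirac (fundamentalRep (Fin 3)) U 0 1).charpoly.roots : ℝ) + (Multiset.countP (fun z : ℂ => |z.re| < c * (reg.a k * m f / reg.Zm k)) (spinorLift gammaFive * wilsonDirac (fundamentalRep (Fin 3)) U (reg.mcrit k + reg.a k * m f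 / reg.Zm k) 1).charpoly.roots : ℝ))) ≤ ε * ((2 * S + 1 : ℝ) / (2 * reg.L k + 1)) ^ 4) ∧ (∃ η : ℝ, 0 < η ∧ ∀ M : ℝ, M₀ < M → ∀ᶠ k in atTop, max 1 (η * (reg.a k * (2 * reg.L k + 1 : ℝ)) ^ 2) ≤ qcdPhaseQuenchedExpect (reg.β k) (2 * reg.L k + 1) (fun f => reg.mcrit k + reg.a k * m f / reg.Zm k) (fun U => |(Multiset.countP (fun z : ℂ => z.re < 0) (spinorLift gammaFive * wilsonDirac (fundamentalRep (Fin 3)) U (reg.mcrit k - reg.a k * M / reg.Zm k) 1).charpoly.roots : ℝ) - 6 * (2 * reg.L k + 1 : ℝ) ^ 4|))) → (∀ m : Fin Nf → ℝ, (∀ f, M₀ < m f) → ∀ᶠ k in atTop, 0 < ∫ (U : GaugeConfig 4 (2 * reg.L k + 1) SU3), (∏ f : Fin Nf, fermionDet (wilsonDirac (fundamentalRep (Fin 3)) U (reg.mcrit k + reg.a k * m f / reg.Zm k) 1)).re ∂(wilsonMeasure (fundamentalRep (Fin 3)) (reg.β k))) → ∀ (M₁ : ℝ), M₀ ≤ M₁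 → (∀ m : Fin Nf → ℝ, (∀ f, M₁ < m f) → ∀ ψ : ℕ → ℕ, StrictMono ψ → ∃ φ : ℕ → ℕ, StrictMono φ ∧ ∀ E : (k S : ℕ) → (GaugeConfig 4 (2 * S + 1) SU3 → ℝ) → ℝ, (∀ (k S : ℕ) (h : GaugeConfig 4 (2 * S + 1) SU3 → ℝ), E k S h = (∫ (U : GaugeConfig 4 (2 * S + 1) SU3), h U * (∏ fl : Fin Nf, fermionDet (Literature.MathematicalPhysics.QuantumLattice.wilsonDiracAP U (reg.mcrit k + reg.a k * m fl / reg.Zm k))).re ∂(wilsonMeasure (fundamentalRep (Fin 3)) (reg.β k))) / ∫ (U : GaugeConfig 4 (2 * S + 1) SU3), (∏ fl : Fin Nf, fermionDet (Literature.MathematicalPhysics.QuantumLattice.wilsonDiracAP U (reg.mcrit k + reg.a k * m fl / reg.Zm k))).re ∂(wilsonMeasure (fundamentalRep (Fin 3)) (reg.β k))) → ∃ (cY mY : YMSpecies SU3 → ℕ → ℝ) (T : OSData (YMSpecies SU3) 4) (Δ : ℝ), 0 < Δ ∧ (∀ n : ℕ, n ≠ 0 → ∀ (σ : Fin n → YMSpecies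 SU3) (f : Fin n → SchwartzMap (EuclideanSpace ℝ (Fin 4)) ℝ) (F : SchwartzMap (Fin n → EuclideanSpace ℝ (Fin 4)) ℂ), IsTensorOf F (fun i => ofRealTest (f i)) → IsOffDiagonal F → Tendsto (fun j : ℕ => (E (ψ (φ j)) (reg.L (ψ (φ j))) (fun U => ∏ i, smearedLatticeField (σ i).F (Literature.Probability.LatticeModels.box 4 (reg.L (ψ (φ j)))) (reg.a (ψ (φ j))) (cY (σ i) (ψ (φ j))) (mY (σ i) (ψ (φ j))) (f i) (torusLift (2 * reg.L (ψ (φ j)) + 1) U)) : ℂ)) atTop (𝓝 (T.schwinger n σ F))) ∧ T.IsNontrivial (fundamentalLatticeRep 3).curvature ∧ T.IsNonGaussian (fundamentalLatticeRep 3).curvature ∧ T.HasMassGap Δ ∧ (∀ A B : YMSpecies SU3, ∃ C : ℝ, ∀ᶠ k in atTop, ∀ S : ℕ, reg.L k ≤ S → ∀ n : ℕ, n ≤ S → |E k S (fun U => A.F (torusLift (2 * S + 1) U) * B.F (configShift (-Pi.single 0 (n : ℤ)) (torusLift (2 * S + 1) U))) - E k S (fun U => A.F (torusLift (2 * S + 1)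 U)) * E k S (fun U => B.F (torusLift (2 * S + 1) U))| ≤ C * Real.exp (-(Δ * (reg.a k * n))))) → ∃ φ : ℕ → ℕ, StrictMono φ ∧ ∃ reg' : QCDRegularisation Nf, reg'.a = reg.a ∘ φ ∧ reg'.β = reg.β ∘ φ ∧ reg'.L = reg.L ∘ φ ∧ reg'.Zm = reg.Zm ∘ φ ∧ reg'.HasMassScaling ∧ ∃ M₂ : ℝ, 0 ≤ M₂ ∧ ∀ m : Fin Nf → ℝ, (∀ f, M₂ < m f) → ∃ (z shift : QCDField Nf → ℕ → ℝ) (T : OSData (QCDField Nf) 4), IsQCDAlong (reg'.scheme m z shift) T ∧ T.IsNontrivial QCDField.glue ∧ T.IsNonGaussian QCDField.glue ∧ (∀ f g : Fin Nf, f ≠ g → T.IsNontrivial (QCDField.pseudoRe f g)) ∧ ∃ Δ > 0, T.HasMassGap Δ ∧ (reg'.scheme m z shift).HasLatticeMassGap Δ := by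
  sorry

/-! ## §2 Glue (proved) -/

/-- **G2 assembled — the honest functional's blocked laws cluster (node ∘ G2b).** -/
theorem blockClusteringAt_of_node {Nf : ℕ} (reg : QCDRegularisation Nf) (m : Fin Nf → ℝ) {ℓ₀ : ℝ}
    {Bl : (k S : ℕ) → GaugeConfig 4 (2 * S + 1) SU3 → GaugeConfig 4 (Mside reg.a ℓ₀ k S) SU3} {Δ : ℝ}
    (hclus : ∀ hgt : ℕ, ∃ C : ℝ, ∀ᶠ k in atTop, ∀ S, reg.L k ≤ S →
      ∀ (t : ℕ) (G₁ G₂ : GaugeConfig 4 (Mside reg.a ℓ₀ k S) SU3 → ℝ) (C₁ C₂ : ℝ), 2 * t ≤ Mside reg.a ℓ₀ k S →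
        Measurable G₁ → Measurable G₂ → (∀ V, |G₁ V| ≤ C₁) → (∀ V, |G₂ V| ≤ C₂) →
        DependsOn G₁ {e | (e.1 0).val < hgt} → DependsOn G₂ {e | (e.1 0).val < hgt} →
        |(∫ U, G₁ (Bl k S U) *
              G₂ (torusConfigShift (Pi.single 0 (t : ZMod (Mside reg.a ℓ₀ k S))) (Bl k S U)) *
              seaWeightAP reg m k S U ∂(Measure.pi fun _ => haarProbability SU3)) /
            (∫ U, seaWeightAP reg m k S U ∂(Measure.pi fun _ => haarProbability SU3)) -
          (∫ U, G₁ (Bl k S U) * seaWeightAP reg m k S U ∂(Measure.pi fun _ => haarProbability SU3)) /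
              (∫ U, seaWeightAP reg m k S U ∂(Measure.pi fun _ => haarProbability SU3)) *
            ((∫ U, G₂ (torusConfigShift (Pi.single 0 (t : ZMod (Mside reg.a ℓ₀ k S))) (Bl k S U)) *
                seaWeightAP reg m k S U ∂(Measure.pi fun _ => haarProbability SU3)) /
              (∫ U, seaWeightAP reg m k S U ∂(Measure.pi fun _ => haarProbability SU3)))| ≤
          C * C₁ * C₂ * Real.exp (-(Δ * (ℓ₀ * t)))) :
    BlockClusteringAt reg m ℓ₀ Bl Δ := by
  have hE : ∀ (k S : ℕ) (h : GaugeConfig 4 (2 * S + 1) SU3 → ℝ), honestExpectAP reg m k S h =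
      (∫ U, h U * seaWeightAP reg m k S U ∂(Measure.pi fun _ => haarProbability SU3)) /
        ∫ U, seaWeightAP reg m k S U ∂(Measure.pi fun _ => haarProbability SU3) :=
    fun k S h => stub_honestExpectAP_eq_haarRatio reg m k S h
  intro hgt
  obtain ⟨C, hC⟩ := hclus hgt
  refine ⟨C, ?_⟩
  filter_upwards [hC] with k hk S hS t G₁ G₂ C₁ C₂ ht hG₁ hG₂ hb₁ hb₂ hd₁ hd₂
  rw [hE, hE, hE]
  exact hk S hS t G₁ G₂ C₁ C₂ ht hG₁ hG₂ hb₁ hb₂ hd₁ hd₂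

/-- **Fine clauses of the honest sea weight (PROVED: Σ/Θ/Π + scalings).** For an SD⁺ witness at `N_f ∈ {2,3}` and any tuple
`m > M₀ ≥ 0`: eventually in `k`, on every torus `S ≥ L_k`, `seaWeightAP reg m` is measurable with positive partition function,
gauge / translation / reflection / permutation invariant and reflection positive — asymptotic scaling gives `β_k ≥ 0`
(`tendsto_beta_atTop_of_hasAsymptoticScaling`), BRANCH gives `m_f(k) > −1`, `a_k L_k → ∞` gives `L_k ≥ 1`; then Σ `stub_seaWeightSymmetric`
(p140739), Π `stub_seaWeightPositive` (p141689), Θ `stub_seaWeightReflectionPositive` (p140751). -/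
theorem fineClausesAt_seaWeightAP {Nf : ℕ} (hNf : Nf = 2 ∨ Nf = 3) (reg : QCDRegularisation Nf) {M₀ c : ℝ}
    (hM₀ : 0 ≤ M₀) (hW : SDPlusWitness Nf reg M₀ c) (m : Fin Nf → ℝ) (hm : ∀ f, M₀ < m f) :
    ∀ᶠ k in atTop, ∀ S, reg.L k ≤ S → FineClausesAt (seaWeightAP reg m) k S := by
  obtain ⟨-, has, -, hbr, -⟩ := hW
  have hNf16 : Nf ≤ 16 := by rcases hNf with rfl | rfl <;> norm_num
  have hβ : ∀ᶠ k in atTop, (0 : ℝ) ≤ reg.β k :=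
    (QCDRegularisation.tendsto_beta_atTop_of_hasAsymptoticScaling hNf16 reg 0 0 0 has).eventually_ge_atTop 0
  have hL : ∀ᶠ k in atTop, 1 ≤ reg.L k := by
    filter_upwards [reg.tendsto_L.eventually_ge_atTop 1] with k hk
    by_contra h0
    push Not at h0
    have : reg.L k = 0 := by omega
    rw [this, Nat.cast_zero, mul_zero] at hk
    exact absurd hk (by norm_num)
  filter_upwards [hβ, hL, hbr] with k hβk hLk hbrk S hS
  have hS1 : 1 ≤ S := le_trans hLk hS
  have hmf : ∀ fl : Fin Nf, -1 < reg.mcrit k + reg.a k * m fl / reg.Zm k := fun fl => by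
    have : 0 ≤ reg.a k * m fl / reg.Zm k :=
      div_nonneg (mul_nonneg (reg.a_pos k).le (le_trans hM₀ (hm fl).le)) (reg.Zm_pos k).le
    linarith
  obtain ⟨h1, h3, h4, h5, h6⟩ := stub_seaWeightSymmetric reg m k S
  exact ⟨h1, stub_seaWeightPositive reg m k S hS1 hβk hmf, h3, h4, h5, h6,
    stub_seaWeightReflectionPositive reg m k S hS1 hβk hmf⟩

/-- **C′ derived (`seaCore_of`): the honest-sea core package above a threshold, from G1, the node (R, unfolded), G2b
and G36.**  G1 gives the format constants; the node gives `β₀`; G1 at `β₀` gives `M₁, ℓ₀` and, tuple by tuple,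
admissible `(βe, Bl)`; the node gives the block clustering of the Haar-ratio functional of the sea weight, which G2b
identifies with the honest functional; G36 turns it into the core package. -/
theorem seaCore_of {Nf : ℕ} (hNf : Nf = 2 ∨ Nf = 3) (reg : QCDRegularisation Nf) (M₀ c : ℝ) (hM₀ : 0 ≤ M₀)
    (hc : 0 < c) (hW : SDPlusWitness Nf reg M₀ c) :
    ∃ M₁ : ℝ, M₀ ≤ M₁ ∧ ∀ m : Fin Nf → ℝ, (∀ f, M₁ < m f) → CorePackageAt reg m := by
  obtain ⟨ε, r, B₀, κ, c₀, cA, A₀, hε, hr, hB₀, hκ, hc₀, hcA, hA₀, hfmt⟩ :=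
    stub_seaBlockFormat hNf reg M₀ c hM₀ hc hW
  obtain ⟨β₀, hβ₀, hnode⟩ := stub_robustYangMillsRG ε r B₀ κ c₀ cA A₀ hε hr hB₀ hκ hc₀ hcA hA₀
  obtain ⟨M₁, hM₁, ℓ₀, hℓ₀, hfm⟩ := hfmt β₀ hβ₀
  refine ⟨M₁, hM₁, fun m hm => ?_⟩
  obtain ⟨βe, Bl, hconv, hblk⟩ := hfm m hm
  have hm₀ : ∀ f, M₀ < m f := fun f => lt_of_le_of_lt hM₁ (hm f)
  -- admissibility = landed fine clauses (Σ/Θ/Π) + G1's block-format clauses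
  have hadm : ∀ᶠ k in atTop, β₀ ≤ βe k ∧ ∀ S, reg.L k ≤ S →
      AdmissiblePosAt ε r B₀ κ c₀ cA A₀ reg.a ℓ₀ (seaWeightAP reg m) βe Bl k S := by
    filter_upwards [fineClausesAt_seaWeightAP hNf reg hM₀ hW m hm₀, hblk] with k hf hb
    exact ⟨hb.1, fun S hS => admissiblePosAt_of (hf S hS) (hb.2 S hS)⟩
  obtain ⟨Δ, hΔ, hclus⟩ := hnode reg.a reg.L reg.a_pos reg.tendsto_a reg.tendsto_L ℓ₀ hℓ₀
    (seaWeightAP reg m) βe Bl hconv hadm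
  exact stub_coreOfBlockGap stub_robustYangMillsRG hNf reg M₀ c hM₀ hc hW ε r B₀ κ c₀ cA A₀ ℓ₀ hε hr hB₀ hκ
    hc₀ hcA hA₀ hℓ₀ m hm₀ βe Bl hconv (hadm.mono fun k hk => hk.2) Δ hΔ
    (blockClusteringAt_of_node reg m hclus)

/-- EXTINCT ∧ TIGHT⁺ (verbatim clauses of SD⁺, raw quotient form) in the `qcdPhaseQuenchedExpect` reading the stubs use
(`qcdPhaseQuenchedExpect_eq_div_prod`, definitional bookkeeping). -/
theorem hypPQ_of_raw {Nf : ℕ} (reg : QCDRegularisation Nf) (M₀ c : ℝ) (m : Fin Nf → ℝ)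
    (hE : ∀ ε : ℝ, 0 < ε → ∀ᶠ k : ℕ in Filter.atTop, ∀ S : ℕ, reg.L k ≤ S → (∫ U, ((∑ f : Fin Nf, ((Multiset.countP (fun z : ℂ => z.im = 0 ∧ z.re < -(reg.mcrit k + reg.a k * m f / reg.Zm k)) (wilsonDirac (fundamentalRep (Fin 3)) U 0 1).charpoly.roots : ℝ) + (Multiset.countP (fun z : ℂ => |z.re| < c * (reg.a k * m f / reg.Zm k)) (spinorLift gammaFive * wilsonDirac (fundamentalRep (Fin 3)) U (reg.mcrit k + reg.a k * m f / reg.Zm k) 1).charpoly.roots : ℝ)))) * ∏ f : Fin Nf, ‖fermionDet (wilsonDirac (fundamentalRep (Fin 3)) U (reg.mcrit k + reg.a k * m f / reg.Zm k) 1)‖ ∂(wilsonMeasure (d := 4) (L := 2 * S + 1) (fundamentalRep (Fin 3)) (reg.β k))) / (∫ U, ∏ f : Fin Nf, ‖fermionDet (wilsonDirac (fundamentalRep (Fin 3)) U (reg.mcrit k + reg.a k * m f / reg.Zm k) 1)‖ ∂(wilsonMeasure (d := 4) (L := 2 * S + 1) (fundamentalRep (Fin 3)) (reg.β k))) ≤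 ε * ((2 * S + 1 : ℝ) / (2 * reg.L k + 1)) ^ 4)
    (hT : ∃ η : ℝ, 0 < η ∧ ∀ M : ℝ, M₀ < M → ∀ᶠ k : ℕ in Filter.atTop, max 1 (η * (reg.a k * (2 * reg.L k + 1 : ℝ)) ^ 2) ≤ (∫ U, (|(Multiset.countP (fun z : ℂ => z.re < 0) (spinorLift gammaFive * wilsonDirac (fundamentalRep (Fin 3)) U (reg.mcrit k - reg.a k * M / reg.Zm k) 1).charpoly.roots : ℝ) - 6 * (2 * reg.L k + 1 : ℝ) ^ 4|) * ∏ f : Fin Nf, ‖fermionDet (wilsonDirac (fundamentalRep (Fin 3)) U (reg.mcrit k + reg.a k * m f / reg.Zm k) 1)‖ ∂(wilsonMeasure (d := 4) (L := 2 * reg.L k + 1) (fundamentalRep (Fin 3)) (reg.β k))) / (∫ U, ∏ f : Fin Nf, ‖fermionDet (wilsonDirac (fundamentalRep (Fin 3)) U (reg.mcrit k + reg.a k * m f / reg.Zm k) 1)‖ ∂(wilsonMeasure (d := 4) (L := 2 * reg.L k + 1) (fundamentalRep (Fin 3)) (reg.β k)))) :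
    (∀ ε : ℝ, 0 < ε → ∀ᶠ k in atTop, ∀ S : ℕ, reg.L k ≤ S → qcdPhaseQuenchedExpect (reg.β k) (2 * S + 1) (fun f => reg.mcrit k + reg.a k * m f / reg.Zm k) (fun U => ∑ f : Fin Nf, ((Multiset.countP (fun z : ℂ => z.im = 0 ∧ z.re < -(reg.mcrit k + reg.a k * m f / reg.Zm k)) (wilsonDirac (fundamentalRep (Fin 3)) U 0 1).charpoly.roots : ℝ) + (Multiset.countP (fun z : ℂ => |z.re| < c * (reg.a k * m f / reg.Zm k)) (spinorLift gammaFive * wilsonDirac (fundamentalRep (Fin 3)) U (reg.mcrit k + reg.a k * m f / reg.Zm k) 1).charpoly.roots : ℝ))) ≤ ε * ((2 * S + 1 : ℝ) / (2 * reg.L k + 1)) ^ 4) ∧ (∃ η : ℝ, 0 < η ∧ ∀ M : ℝ, M₀ < M → ∀ᶠ k in atTop, max 1 (η * (reg.a k * (2 * reg.L k + 1 : ℝ)) ^ 2) ≤ qcdPhaseQuenchedExpect (reg.β k) (2 * reg.L k + 1) (fun f => reg.mcrit k + reg.a k * m f / reg.Zm k) (fun U => |(Multiset.countP (fun z : ℂ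 => z.re < 0) (spinorLift gammaFive * wilsonDirac (fundamentalRep (Fin 3)) U (reg.mcrit k - reg.a k * M / reg.Zm k) 1).charpoly.roots : ℝ) - 6 * (2 * reg.L k + 1 : ℝ) ^ 4|)) := by
  refine ⟨fun ε hε => ?_, ?_⟩
  · filter_upwards [hE ε hε] with k hk S hS
    rw [qcdPhaseQuenchedExpect_eq_div_prod]
    exact hk S hS
  · obtain ⟨η, hη, h⟩ := hT
    refine ⟨η, hη, fun M hM => ?_⟩
    filter_upwards [h M hM] with k hk
    rw [qcdPhaseQuenchedExpect_eq_div_prod]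
    exact hk

/-! ## §3 The composition: the skeleton concludes the crux BY NAME -/

/-- **`ExtinctionBuildsQCD_of` — the crux from the registered stubs.** `T ∘ seaCore_of(G1, R, G2b, G36) ∘ (E, P,
hypPQ_of_raw)`: unpack SD⁺; read EXTINCT/TIGHT⁺ phase-quenched; E+P give the positivity of the honest periodic partition
function above `M₀`; `seaCore_of` gives the core package above `M₁`; T turns it into the threshold body along
`reg' = reg ∘ φ`. -/
theorem ExtinctionBuildsQCD_of : ExtinctionBuildsQCD := by
  intro Nf hNf hSD
  obtain ⟨reg, hms, has, hcap, hbr, M₀, hM₀, c, hc, hSDm⟩ := hSD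
  -- phase-quenched reading of the two clauses, tuple by tuple
  have hpq := fun (m : Fin Nf → ℝ) (hm : ∀ f, M₀ < m f) =>
    hypPQ_of_raw reg M₀ c m (hSDm m hm).1 (hSDm m hm).2
  -- E + P: the honest periodic partition function is positive at the scheme's own side, above M₀
  have hP : ∀ m : Fin Nf → ℝ, (∀ f, M₀ < m f) → ∀ᶠ k in atTop,
      0 < ∫ (U : GaugeConfig 4 (2 * reg.L k + 1) SU3), (∏ f : Fin Nf, fermionDet (wilsonDirac
        (fundamentalRep (Fin 3)) U (reg.mcrit k + reg.a k * m f / reg.Zm k) 1)).re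
          ∂(wilsonMeasure (fundamentalRep (Fin 3)) (reg.β k)) :=
    fun m hm => stub_honestPartitionPos reg m (stub_signHalfOfExtinct reg c m (hSDm m hm).1)
  -- C′ (derived): the honest-sea core package above M₁
  obtain ⟨M₁, hM₁, hcore⟩ := seaCore_of hNf reg M₀ c hM₀ hc ⟨hms, has, hcap, hbr, hpq⟩
  -- T: flavoured threshold QCD along reg ∘ φ
  obtain ⟨φ, -, reg', -, -, -, -, hms', M₂, hM₂, hbody⟩ := stub_flavouredThreshold stub_robustYangMillsRG
    Nf hNf reg M₀ c hM₀ hc hms has hbr hpq hP M₁ hM₁ hcore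
  exact ⟨reg', hms', M₂, hM₂, hbody⟩

end Summit.QuantumFields.QCD.Cruxes.ExtinctionBuildsQCD.BlockAwayTheSign

end
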